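import Mathlib
import HarnessLib
import HarnessLib.Audit
import Summits.CriticalPhenomena.PercolationContinuityZ3.Theorems.PercNearOneGluingNoHeavyLowerTailHexMSReduction

/-!
# HEX-MS: the complement-symmetric form Δ-HEX and its one-lemma reduction Δ-R_n (hp-7 gen 65)

Support file for crux `stmt-CriticalPhenomena-4575` (route `PercNearOneGluingNoHeavy`), hull-port seat `prim-hp-7` (generation 65);
`--supports stmt-CriticalPhenomena-4575`.  No `sorry`.  Memo: `run/shared/lean/prim/prim-hp-7/FROM-prim-hp-7-g65-REDUCTIONS.md` §0(0).

For an antipodal instance `(U, 𝒟, x)` let `symGen U 𝒟 x := gen 𝒟 x ∪ {U \ p : p ∈ gen 𝒟 x}` — the far MEETS together with the far JOINS.  Two new statements: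

* `DeltaHexRel U 𝒟 x` : `#𝒟 ≤ #(symGen U 𝒟 x)` (**Conjecture Δ-HEX**; it implies HEX-MS since `#symGen ≤ 2 · #gen`; it is tight for every labelling of a full cube;
  exhaustive for all antipodal labellings of `2^[3]`, `2^[4]`, annealing n ≤ 7: 0 failures);
* `DeltaRn` : every nonempty antipodal instance has a direction `r ∈ U` in which `symGen` has at least as many cube edges as `𝒟`:
  `#(twins 𝒟 r) ≤ #(edgesAt (symGen U 𝒟 x) r)` (**Conjecture Δ-R_n**; exhaustive n ≤ 4, annealing n ≤ 7, exact SAT n ≤ 8 submitted).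

Main results: `deltaHexRel_of_deltaRn : DeltaRn → DeltaHexRel U 𝒟 x` for every ground set (induction on `#U` through the coordinate reduction of the
companion file — because `symGen` is closed under `U \ ·` the projection identity applies to it verbatim and the dense-case obstruction of plain `gen` disappears),
and `hexMS_of_deltaRn : DeltaRn → HexMS`.  So Conjecture HEX-MS (g64) is reduced to the single local statement Δ-R_n.  Both `DeltaRn` and `DeltaHexRel` are
`def … : Prop` obligations, never asserted.
-/

namespace Summit.CriticalPhenomena.PercolationContinuityZ3.Theorems

namespace GeneratedDonors

open Finset

variable {α : Type*} [DecidableEq α]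

section Statements

/-- Far meets together with far joins: the generated family closed under complementation inside `U`. -/
def symGen (U : Finset α) (𝒟 : Finset (Finset α)) (x : Finset α → ZMod 6) : Finset (Finset α) :=
  gen 𝒟 x ∪ (gen 𝒟 x).image fun p => U \ p

/-- The `r`-twins of `𝒟`: members `e` with `r ∉ e` and `insert r e ∈ 𝒟` (lower ends of the cube edges of `𝒟` in direction `r`). -/
def twins (𝒟 : Finset (Finset α)) (r : α) : Finset (Finset α) :=
  𝒟.filter fun e => r ∉ e ∧ insert r e ∈ 𝒟

/-- Membership in `twins`. -/
theorem mem_twins {𝒟 : Finset (Finset α)} {r : α} {e : Finset α} :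
    e ∈ twins 𝒟 r ↔ e ∈ 𝒟 ∧ r ∉ e ∧ insert r e ∈ 𝒟 := by
  unfold twins; rw [mem_filter]

/-- **Δ-HEX relative to a ground set** (conjecture): the far meets and far joins of an antipodal instance number at least `#𝒟`. -/
def DeltaHexRel (U : Finset α) (𝒟 : Finset (Finset α)) (x : Finset α → ZMod 6) : Prop :=
  (∀ a ∈ 𝒟, a ⊆ U) → (∀ a ∈ 𝒟, U \ a ∈ 𝒟) → (∀ a ∈ 𝒟, x (U \ a) = x a + 3) → #𝒟 ≤ #(symGen U 𝒟 x)

/-- **Conjecture Δ-R_n** (hp-7 g65; open): every nonempty antipodal instance has a direction `r ∈ U` in which the family of far meets and joins has at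
least as many cube edges as the instance itself.  Exhaustive n ≤ 4 (5 764 800 labellings, 0 failures), annealing n ≤ 7; the 'for every r' form is false. -/
def DeltaRn : Prop :=
  ∀ (α : Type) [DecidableEq α] (U : Finset α) (𝒟 : Finset (Finset α)) (x : Finset α → ZMod 6),
    (∀ a ∈ 𝒟, a ⊆ U) → (∀ a ∈ 𝒟, U \ a ∈ 𝒟) → (∀ a ∈ 𝒟, x (U \ a) = x a + 3) → 𝒟.Nonempty →
    ∃ r ∈ U, #(twins 𝒟 r) ≤ #(edgesAt (symGen U 𝒟 x) r)

end Statements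

section Reduction

variable {U : Finset α} {r : α} {𝒟 ℰ₀ : Finset (Finset α)} {x : Finset α → ZMod 6}

/-- `symGen` is at most twice `gen`. -/
theorem card_symGen_le (U : Finset α) (𝒟 : Finset (Finset α)) (x : Finset α → ZMod 6) :
    #(symGen U 𝒟 x) ≤ 2 * #(gen 𝒟 x) := by
  unfold symGen
  have h1 := card_union_le (gen 𝒟 x) ((gen 𝒟 x).image fun p => U \ p)
  have h2 : #((gen 𝒟 x).image fun p => U \ p) ≤ #(gen 𝒟 x) := card_image_le
  omega

/-- Products of an instance on `U` lie inside `U`. -/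
theorem gen_subset_ground (hU : ∀ a ∈ 𝒟, a ⊆ U) {p : Finset α} (hp : p ∈ gen 𝒟 x) : p ⊆ U := by
  obtain ⟨a, ha, b, _, _, rfl⟩ := mem_gen.mp hp
  exact sdiff_subset.trans (hU a ha)

/-- **The symmetric generated family of the reduced instance projects into that of `𝒟`.** -/
theorem symGen_reduced_subset (h : ReductionData U r 𝒟 ℰ₀) (hU : ∀ a ∈ 𝒟, a ⊆ U) (hco : ∀ a ∈ 𝒟, U \ a ∈ 𝒟)
    (hanti : ∀ a ∈ 𝒟, x (U \ a) = x a + 3) :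
    symGen (U.erase r) (reducedFamily U r ℰ₀) (reducedLabel U r ℰ₀ x) ⊆ (symGen U 𝒟 x).image fun p => p.erase r := by
  intro q hq
  unfold symGen at hq ⊢
  rw [mem_union] at hq
  rcases hq with hq | hq
  · obtain ⟨p, hp, rfl⟩ := mem_image.mp (gen_reduced_subset h hU hco hanti hq)
    exact mem_image.mpr ⟨p, mem_union_left _ hp, rfl⟩
  · obtain ⟨q', hq', rfl⟩ := mem_image.mp hq
    obtain ⟨p, hp, rfl⟩ := mem_image.mp (gen_reduced_subset h hU hco hanti hq')
    refine mem_image.mpr ⟨U \ p, mem_union_right _ (mem_image.mpr ⟨p, hp, rfl⟩), ?_⟩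
    have hpU : p ⊆ U := gen_subset_ground hU hp
    ext i
    simp only [mem_erase, mem_sdiff]
    tauto

/-- **Coordinate reduction for Δ-HEX**: Δ-HEX for the reduced instance on `U.erase r` and the edge hypothesis `#twins-count ≤ …` in the form
`#𝒟 ≤ 2 #ℰ₀ + #(edgesAt (symGen U 𝒟 x) r)` give `#𝒟 ≤ #(symGen U 𝒟 x)`. -/
theorem card_le_card_symGen_of_reduction (h : ReductionData U r 𝒟 ℰ₀) (hU : ∀ a ∈ 𝒟, a ⊆ U)
    (hco : ∀ a ∈ 𝒟, U \ a ∈ 𝒟) (hanti : ∀ a ∈ 𝒟, x (U \ a) = x a + 3)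
    (hIH : DeltaHexRel (U.erase r) (reducedFamily U r ℰ₀) (reducedLabel U r ℰ₀ x))
    (hedges : #𝒟 ≤ 2 * #ℰ₀ + #(edgesAt (symGen U 𝒟 x) r)) :
    #𝒟 ≤ #(symGen U 𝒟 x) := by
  have h1 : #(reducedFamily U r ℰ₀) ≤ #(symGen (U.erase r) (reducedFamily U r ℰ₀) (reducedLabel U r ℰ₀ x)) :=
    hIH (reducedFamily_subset h hU) (reducedFamily_compl h hU) (reducedLabel_anti h hU)
  rw [card_reducedFamily h hU] at h1
  have h2 := card_le_card (symGen_reduced_subset h hU hco hanti)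
  have h3 := card_eq_card_image_erase_add_card_edgesAt (symGen U 𝒟 x) r
  omega

end Reduction

section Architecture

/-- The complement map inside `U.erase r` preserves the `r`-twins of an antipodal instance on `U`. -/
theorem compl_erase_mem_twins {U : Finset α} {r : α} {𝒟 : Finset (Finset α)} (hr : r ∈ U)
    (hco : ∀ a ∈ 𝒟, U \ a ∈ 𝒟) {e : Finset α} (he : e ∈ twins 𝒟 r) :
    (U.erase r) \ e ∈ twins 𝒟 r := by
  rw [mem_twins] at he ⊢
  obtain ⟨heD, hre, hins⟩ := he
  have h1 : (U.erase r) \ e = U \ insert r e := by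
    ext i; simp only [mem_sdiff, mem_erase, mem_insert]; tauto
  have h2 : insert r ((U.erase r) \ e) = U \ e := by
    ext i
    simp only [mem_insert, mem_sdiff, mem_erase]
    constructor
    · rintro (rfl | ⟨⟨_, hiU⟩, hie⟩)
      · exact ⟨hr, hre⟩
      · exact ⟨hiU, hie⟩
    · rintro ⟨hiU, hie⟩
      by_cases hir : i = r
      · exact Or.inl hir
      · exact Or.inr ⟨⟨hir, hiU⟩, hie⟩
  refine ⟨by rw [h1]; exact hco _ hins, by simp, by rw [h2]; exact hco e heD⟩

/-- In an antipodal instance on `U` with `r ∈ U`, the `r`-free members are exactly half of `𝒟`. -/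
theorem card_eq_two_mul_card_rfree {U : Finset α} {r : α} {𝒟 : Finset (Finset α)} (hr : r ∈ U)
    (hU : ∀ a ∈ 𝒟, a ⊆ U) (hco : ∀ a ∈ 𝒟, U \ a ∈ 𝒟) :
    #𝒟 = 2 * #(𝒟.filter fun e => r ∉ e) := by
  set E : Finset (Finset α) := 𝒟.filter fun e => r ∉ e with hE
  have hcc : ∀ a ∈ 𝒟, U \ (U \ a) = a := fun a ha => Finset.sdiff_sdiff_eq_self (hU a ha)
  have himg : 𝒟.filter (fun e => ¬ r ∉ e) = E.image fun e => U \ e := by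
    ext a
    rw [mem_filter, mem_image]
    constructor
    · rintro ⟨ha, hra⟩
      refine ⟨U \ a, ?_, hcc a ha⟩
      rw [hE, mem_filter]
      exact ⟨hco a ha, fun h => (mem_sdiff.mp h).2 (not_not.mp hra)⟩
    · rintro ⟨e, he, rfl⟩
      rw [hE, mem_filter] at he
      exact ⟨hco e he.1, fun h => h (mem_sdiff.mpr ⟨hr, he.2⟩)⟩
  have hinj : Set.InjOn (fun e : Finset α => U \ e) (E : Set (Finset α)) := by
    intro e he f hf hef
    rw [mem_coe, hE, mem_filter] at he hf
    have := congrArg (fun s => U \ s) hef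
    simp only [hcc e he.1, hcc f hf.1] at this
    exact this
  have key := card_filter_add_card_filter_not (s := 𝒟) (fun e => r ∉ e)
  rw [himg, card_image_of_injOn hinj, ← hE] at key
  omega

/-- **Δ-R_n ⟹ Δ-HEX** (with an explicit size bound for the induction on the ground set). -/
theorem deltaHexRel_of_deltaRn_aux (hΔ : DeltaRn) :
    ∀ (γ : Type) [DecidableEq γ] (N : ℕ) (U : Finset γ) (𝒟 : Finset (Finset γ)) (x : Finset γ → ZMod 6),
      #U ≤ N → DeltaHexRel U 𝒟 x := by
  intro γ _ N
  induction N with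
  | zero =>
    intro U 𝒟 x hN hU hco hanti
    -- U = ∅ forces 𝒟 = ∅ (antipodality)
    have hUe : U = ∅ := card_eq_zero.mp (by omega)
    by_cases hD : 𝒟 = ∅
    · rw [hD]; simp
    · obtain ⟨d, hd⟩ := nonempty_iff_ne_empty.mpr hD
      have hd0 : d = ∅ := subset_empty.mp (hUe ▸ hU d hd)
      have := hanti d hd
      rw [hd0, hUe, sdiff_empty] at this
      have h6 : ∀ z : ZMod 6, z ≠ z + 3 := by decide
      exact absurd this (h6 _)
  | succ N ih =>
    intro U 𝒟 x hN hU hco hanti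
    classical
    by_cases hD : 𝒟 = ∅
    · rw [hD]; simp
    by_cases hsmall : #𝒟 ≤ 2
    · obtain ⟨d, hd⟩ := nonempty_iff_ne_empty.mpr hD
      have h0 : d \ d ∈ gen 𝒟 x := mem_gen.mpr ⟨d, hd, d, hd, Or.inl rfl, rfl⟩
      have h1 : d \ d ∈ symGen U 𝒟 x := by unfold symGen; exact mem_union_left _ h0
      have h2 : U \ (d \ d) ∈ symGen U 𝒟 x := by unfold symGen; exact mem_union_right _ (mem_image.mpr ⟨_, h0, rfl⟩)
      have hne : d \ d ≠ U \ (d \ d) := by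
        rw [sdiff_self, Finset.bot_eq_empty, sdiff_empty]
        intro hUe
        have hd0 : d = ∅ := subset_empty.mp (hUe ▸ hU d hd)
        have := hanti d hd
        rw [hd0, ← hUe, sdiff_empty] at this
        have h6 : ∀ z : ZMod 6, z ≠ z + 3 := by decide
        exact h6 _ this
      have : 2 ≤ #(symGen U 𝒟 x) := by
        have := Finset.one_lt_card.mpr ⟨_, h1, _, h2, hne⟩
        omega
      omega
    -- a good direction from Δ-R_n
    obtain ⟨r, hr, hedge⟩ := hΔ γ U 𝒟 x hU hco hanti (nonempty_iff_ne_empty.mpr hD)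
    -- a half H of the twins under the complement-in-(U.erase r) involution
    set σ : Finset γ → Finset γ := fun e => (U.erase r) \ e with hσ
    have hcl : ∀ s ∈ twins 𝒟 r, σ s ∈ twins 𝒟 r := fun s hs => compl_erase_mem_twins hr hco hs
    have hsubTw : ∀ s ∈ twins 𝒟 r, s ⊆ U.erase r := by
      intro s hs i hi
      obtain ⟨hsD, hrs, _⟩ := mem_twins.mp hs
      exact mem_erase.mpr ⟨fun h => hrs (h ▸ hi), hU s hsD hi⟩
    have hinv : ∀ s ∈ twins 𝒟 r, σ (σ s) = s := fun s hs => Finset.sdiff_sdiff_eq_self (hsubTw s hs)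
    have hfix : ∀ s ∈ twins 𝒟 r, σ s ≠ s := by
      intro s hs h
      obtain ⟨hsD, hrs, hins⟩ := mem_twins.mp hs
      have hs0 : s = ∅ := by
        apply eq_empty_of_forall_notMem
        intro i hi
        have : i ∈ σ s := h.symm ▸ hi
        exact (mem_sdiff.mp this).2 hi
      have hUe : U.erase r = ∅ := by
        have : σ s = ∅ := by rw [h, hs0]
        simpa [hσ, hs0] using this
      have hsub1 : ∀ a ∈ 𝒟, a ⊆ {r} := by
        intro a ha i hi
        rw [mem_singleton]
        by_contra hir
        have : i ∈ U.erase r := mem_erase.mpr ⟨hir, hU a ha hi⟩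
        rw [hUe] at this
        exact notMem_empty i this
      have hDsub : 𝒟 ⊆ ({r} : Finset γ).powerset := fun a ha => mem_powerset.mpr (hsub1 a ha)
      have : #𝒟 ≤ 2 := by
        have := card_le_card hDsub
        rw [card_powerset, card_singleton] at this
        exact this
      omega
    obtain ⟨H, hHsub, hHfree, hHcov⟩ := exists_half_of_involution σ (twins 𝒟 r) hcl hinv hfix
    have hcardTw : #(twins 𝒟 r) = 2 * #H := card_eq_two_mul_card_half σ _ H hcl hinv hHsub hHfree hHcov
    set E : Finset (Finset γ) := 𝒟.filter fun e => r ∉ e with hE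
    set E0 : Finset (Finset γ) := (E \ twins 𝒟 r) ∪ H with hE0
    have hTwE : twins 𝒟 r ⊆ E := fun s hs => by
      rw [hE, mem_filter]; exact ⟨(mem_twins.mp hs).1, (mem_twins.mp hs).2.1⟩
    have hRD : ReductionData U r 𝒟 E0 := by
      refine ⟨?_, ?_, ?_⟩
      · intro e he
        rw [hE0, mem_union, mem_sdiff] at he
        rcases he with ⟨he, _⟩ | he
        · exact (mem_filter.mp he).1
        · exact (mem_twins.mp (hHsub he)).1
      · intro e he
        rw [hE0, mem_union, mem_sdiff] at he
        rcases he with ⟨he, _⟩ | he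
        · exact (mem_filter.mp he).2
        · exact (mem_twins.mp (hHsub he)).2.1
      · intro e he hce
        rw [hE0, mem_union, mem_sdiff] at he hce
        have htw_of : ∀ f ∈ E, (U.erase r) \ f ∈ E → f ∈ twins 𝒟 r := by
          intro f hf hcf
          rw [hE, mem_filter] at hf hcf
          refine mem_twins.mpr ⟨hf.1, hf.2, ?_⟩
          have : U \ ((U.erase r) \ f) = insert r f := by
            ext i
            simp only [mem_sdiff, mem_erase, mem_insert, not_and, not_not]
            constructor
            · rintro ⟨hiU, h2⟩
              by_cases hir : i = r
              · exact Or.inl hir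
              · exact Or.inr (h2 ⟨hir, hiU⟩)
            · rintro (rfl | hif)
              · exact ⟨hr, fun h => absurd rfl h.1⟩
              · exact ⟨hU f hf.1 hif, fun _ => hif⟩
          rw [← this]; exact hco _ hcf.1
        rcases he with ⟨heE, henT⟩ | heH
        · rcases hce with ⟨hcE, _⟩ | hcH
          · exact henT (htw_of e heE hcE)
          · have hcT := hHsub hcH
            have : e ∈ twins 𝒟 r := by
              have := hcl _ hcT
              rwa [show σ ((U.erase r) \ e) = e from
                Finset.sdiff_sdiff_eq_self (fun i hi => mem_erase.mpr
                  ⟨fun h => (mem_filter.mp heE).2 (h ▸ hi), hU e (mem_filter.mp heE).1 hi⟩)] at this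
            exact henT this
        · rcases hce with ⟨_, hcnT⟩ | hcH
          · exact hcnT (hcl e (hHsub heH))
          · exact hHfree e heH hcH
    have hcardD : #𝒟 = 2 * #E := card_eq_two_mul_card_rfree hr hU hco
    have hcardE0 : #E0 + #H = #E := by
      have hdisj : Disjoint (E \ twins 𝒟 r) H := by
        rw [disjoint_left]; intro s hs hsH; exact (mem_sdiff.mp hs).2 (hHsub hsH)
      rw [hE0, card_union_of_disjoint hdisj, card_sdiff_of_subset hTwE, hcardTw]
      have : #(twins 𝒟 r) ≤ #E := card_le_card hTwE
      omega
    have hIH : DeltaHexRel (U.erase r) (reducedFamily U r E0) (reducedLabel U r E0 x) := by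
      apply ih
      have h1 : #(U.erase r) < #U := card_erase_lt_of_mem hr
      omega
    apply card_le_card_symGen_of_reduction hRD hU hco hanti hIH
    omega

/-- **Δ-R_n ⟹ Δ-HEX** for every ground set. -/
theorem deltaHexRel_of_deltaRn (hΔ : DeltaRn) {γ : Type} [DecidableEq γ] (U : Finset γ) (𝒟 : Finset (Finset γ))
    (x : Finset γ → ZMod 6) : DeltaHexRel U 𝒟 x :=
  deltaHexRel_of_deltaRn_aux hΔ γ (#U) U 𝒟 x le_rfl

/-- **Δ-R_n ⟹ HEX-MS** (relative form): from `#𝒟 ≤ #symGen ≤ 2 · #gen`. -/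
theorem hexMSRel_of_deltaRn (hΔ : DeltaRn) {γ : Type} [DecidableEq γ] (U : Finset γ) (𝒟 : Finset (Finset γ))
    (x : Finset γ → ZMod 6) : HexMSRel U 𝒟 x := by
  intro hU hco hanti
  have h1 := deltaHexRel_of_deltaRn hΔ U 𝒟 x hU hco hanti
  have h2 := card_symGen_le U 𝒟 x
  omega

/-- **Δ-R_n ⟹ Conjecture HEX-MS** (g64's `HexMS`, all finite types). -/
theorem hexMS_of_deltaRn (hΔ : DeltaRn) : HexMS := by
  intro γ _ _ 𝒟 x
  classical
  exact (hexMSRel_univ_iff 𝒟 x).mp (hexMSRel_of_deltaRn hΔ univ 𝒟 x)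

end Architecture

end GeneratedDonors

end Summit.CriticalPhenomena.PercolationContinuityZ3.Theorems
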